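import Summits.Ventures.HodgeRepro2.T5SU11JacobiTransform

/-!
# The simple poles: `(1 − λ) c(λ) → 2/π` at the critical parameter, and
`(k − λ) m̂_k(λ) → 2^{k−1} C_k` at the edge of the strip of convergence

From the closed forms of `T5SU11SphericalCfunClosed` (`c(λ) = Γ((1−λ)/2)/(√π Γ(1−λ/2))`) and
`T5SU11JacobiTransform` (`m̂_k(λ) = 2^{k−2} C_k Γ((k−λ)/2) Γ((k+λ)/2 − 1)/Γ(k−1)`), the simple pole of `Γ`
at `0` with residue `1` (`Real.tendsto_self_mul_Gamma_nhds_zero`, the real form of Mathlib's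
`Complex.tendsto_self_mul_Gamma_nhds_zero`) gives the EXACT rates: **`(1 − λ) c(λ) → 2/π` as `λ → 1⁻`**
(`tendsto_one_sub_mul_cfun`), sharpening the lower bound `c(λ) ≥ 1/(π(1 − λ))` of
`T5SU11SphericalCfunLimit` to an asymptotic equality, and **`(k − λ) m̂_k(λ) → 2^{k−1} C_k` as `λ → k⁻`**
(`tendsto_sub_mul_jacobi_nhdsLT`; by `W`-symmetry also `(λ − (2 − k)) m̂_k(λ) → 2^{k−1} C_k` as
`λ → (2 − k)⁺`, `tendsto_jacobi_nhdsGT`): the Jacobi transform of the coefficient modulus has simple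
poles at both ends of its strip of convergence `|λ − 1| < k − 1` (`T5SU11JacobiThreshold`), with residue
`2^{k−1} √π Γ((k−1)/2)/Γ(k/2)`. Nothing is claimed about (N).

Blind lane: Mathlib + the HodgeRepro2 prefix only; no sorry; axioms ⊆ {propext, Classical.choice,
Quot.sound}.
-/

namespace Summit.Ventures.HodgeRepro2.T5SU11CfunPole

open MeasureTheory Metric Set Filter Topology
open T5SU11Unimodular T5SU11Fibration T5SU11Cartan T5HaarCircle T5BergmanCoefficient
  T5SU11FibrationHaar T5SU11SphericalFunction T5SU11SphericalAsymptotic T5SU11SphericalCfunClosed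
  T5SU11JacobiIwasawa T5SU11JacobiTransform
open scoped Real

/-! ### The simple pole of the real Gamma function at `0` -/

/-- **`z Γ(z) → 1` as `z → 0`** (real form). -/
theorem tendsto_self_mul_Gamma_nhds_zero :
    Tendsto (fun z : ℝ => z * Real.Gamma z) (𝓝[≠] 0) (𝓝 1) := by
  have h1 : Tendsto (fun z : ℝ => Real.Gamma (z + 1)) (𝓝[≠] 0) (𝓝 1) := by
    have hc : ContinuousAt Real.Gamma 1 :=
      (Real.differentiableAt_Gamma fun m => by
        have : (0 : ℝ) ≤ m := Nat.cast_nonneg m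
        linarith).continuousAt
    have h2 : Tendsto (fun z : ℝ => z + 1) (𝓝[≠] 0) (𝓝 (0 + 1)) :=
      (continuous_id.add continuous_const).continuousAt.tendsto.mono_left nhdsWithin_le_nhds
    rw [zero_add] at h2
    have h3 := hc.tendsto.comp h2
    rwa [Real.Gamma_one] at h3
  refine h1.congr' (eventually_nhdsWithin_of_forall fun z hz => ?_)
  exact Real.Gamma_add_one hz

/-! ### The pole of the `c`-function at the critical parameter -/

/-- `(1 − λ)/2 → 0` within `≠ 0` as `λ → 1⁻`. -/
lemma tendsto_one_sub_div_two_nhdsLT :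
    Tendsto (fun lam : ℝ => (1 - lam) / 2) (𝓝[<] 1) (𝓝[≠] 0) := by
  refine tendsto_nhdsWithin_iff.mpr ⟨?_, eventually_nhdsWithin_of_forall fun lam hlam => ?_⟩
  · have : Tendsto (fun lam : ℝ => (1 - lam) / 2) (𝓝 1) (𝓝 ((1 - 1) / 2)) :=
      ((continuous_const.sub continuous_id).div_const 2).continuousAt.tendsto
    rw [sub_self, zero_div] at this
    exact this.mono_left nhdsWithin_le_nhds
  · have : (0 : ℝ) < (1 - lam) / 2 := by
      have : lam < 1 := hlam
      linarith
    exact this.ne'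

/-- **THE EXACT POLE OF THE `c`-FUNCTION**: `(1 − λ) c(λ) → 2/π` as `λ → 1⁻`. -/
theorem tendsto_one_sub_mul_cfun :
    Tendsto (fun lam : ℝ => (1 - lam) * cfun lam) (𝓝[<] 1) (𝓝 (2 / π)) := by
  have hπ : 0 < π := Real.pi_pos
  have hs : 0 < √π := Real.sqrt_pos.mpr hπ
  -- the closed form on `λ < 1`
  have e : ∀ lam : ℝ, lam < 1 → (1 - lam) * cfun lam
      = 2 * (((1 - lam) / 2) * Real.Gamma ((1 - lam) / 2)) / (√π * Real.Gamma (1 - lam / 2)) := by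
    intro lam hlam
    rw [cfun_eq_gamma hlam]
    field_simp
  -- the two limits
  have h1 : Tendsto (fun lam : ℝ => ((1 - lam) / 2) * Real.Gamma ((1 - lam) / 2)) (𝓝[<] 1) (𝓝 1) :=
    tendsto_self_mul_Gamma_nhds_zero.comp tendsto_one_sub_div_two_nhdsLT
  have h2 : Tendsto (fun lam : ℝ => √π * Real.Gamma (1 - lam / 2)) (𝓝[<] 1) (𝓝 (√π * √π)) := by
    have hc : ContinuousAt Real.Gamma (1 / 2) :=
      (Real.differentiableAt_Gamma fun m => by
        have : (0 : ℝ) ≤ m := Nat.cast_nonneg m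
        linarith).continuousAt
    have h3 : Tendsto (fun lam : ℝ => 1 - lam / 2) (𝓝[<] 1) (𝓝 (1 - 1 / 2)) :=
      ((continuous_const.sub (continuous_id.div_const 2)).continuousAt.tendsto).mono_left
        nhdsWithin_le_nhds
    rw [show (1 : ℝ) - 1 / 2 = 1 / 2 by norm_num] at h3
    rw [← Real.Gamma_one_half_eq]
    exact tendsto_const_nhds.mul (hc.tendsto.comp h3)
  have h : Tendsto (fun lam : ℝ => 2 * (((1 - lam) / 2) * Real.Gamma ((1 - lam) / 2))
      / (√π * Real.Gamma (1 - lam / 2))) (𝓝[<] 1) (𝓝 (2 * 1 / (√π * √π))) :=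
    (tendsto_const_nhds.mul h1).div h2 (by positivity)
  rw [mul_one, Real.mul_self_sqrt hπ.le] at h
  exact h.congr' (eventually_nhdsWithin_of_forall fun lam hlam => (e lam hlam).symm)

/-! ### The poles of the Jacobi transform at the ends of its strip -/

/-- `(k − λ)/2 → 0` within `≠ 0` as `λ → k⁻`. -/
lemma tendsto_sub_div_two_nhdsLT (k : ℝ) :
    Tendsto (fun lam : ℝ => (k - lam) / 2) (𝓝[<] k) (𝓝[≠] 0) := by
  refine tendsto_nhdsWithin_iff.mpr ⟨?_, eventually_nhdsWithin_of_forall fun lam hlam => ?_⟩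
  · have : Tendsto (fun lam : ℝ => (k - lam) / 2) (𝓝 k) (𝓝 ((k - k) / 2)) :=
      ((continuous_const.sub continuous_id).div_const 2).continuousAt.tendsto
    rw [sub_self, zero_div] at this
    exact this.mono_left nhdsWithin_le_nhds
  · have : (0 : ℝ) < (k - lam) / 2 := by
      have : lam < k := hlam
      linarith
    exact this.ne'

section measure

variable [MeasurableSpace Circle] [BorelSpace Circle]

/-- **THE POLE OF THE JACOBI TRANSFORM AT `λ = k`**: for `k > 1`,
`(k − λ) ∫_G m_k φ_λ dν → 2^{k−1} √π Γ((k−1)/2)/Γ(k/2)` as `λ → k⁻`. -/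
theorem tendsto_sub_mul_jacobi_nhdsLT {k : ℝ} (hk : 1 < k) :
    Tendsto (fun lam : ℝ => (k - lam) * ∫ g, (1 - ‖orbit g‖ ^ 2) ^ (k / 2) * sph lam g ∂(nu haarCircle))
      (𝓝[<] k) (𝓝 (2 ^ (k - 1) * (√π * Real.Gamma ((k - 1) / 2) / Real.Gamma (k / 2)))) := by
  have hΓ : 0 < Real.Gamma (k - 1) := Real.Gamma_pos_of_pos (by linarith)
  -- the closed form near `k`
  have e : ∀ᶠ lam in 𝓝[<] k, (k - lam) * ∫ g, (1 - ‖orbit g‖ ^ 2) ^ (k / 2) * sph lam g ∂(nu haarCircle)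
      = 2 ^ (k - 1) * (√π * Real.Gamma ((k - 1) / 2) / Real.Gamma (k / 2))
        * ((((k - lam) / 2) * Real.Gamma ((k - lam) / 2))
          * (Real.Gamma ((k + lam) / 2 - 1) / Real.Gamma (k - 1))) := by
    have hev : ∀ᶠ lam in 𝓝[<] k, 2 - k < lam := by
      refine eventually_nhdsWithin_of_eventually_nhds ?_
      exact eventually_gt_nhds (by linarith)
    filter_upwards [hev, self_mem_nhdsWithin] with lam h1 h2
    rw [integral_orbit_rpow_mul_sph hk h2 (by linarith),
      show (2 : ℝ) ^ (k - 1) = 2 ^ (k - 2) * 2 by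
        rw [show k - 1 = (k - 2) + 1 by ring, Real.rpow_add (by norm_num), Real.rpow_one]]
    ring
  -- the limits
  have h1 : Tendsto (fun lam : ℝ => ((k - lam) / 2) * Real.Gamma ((k - lam) / 2)) (𝓝[<] k) (𝓝 1) :=
    tendsto_self_mul_Gamma_nhds_zero.comp (tendsto_sub_div_two_nhdsLT k)
  have h2 : Tendsto (fun lam : ℝ => Real.Gamma ((k + lam) / 2 - 1) / Real.Gamma (k - 1)) (𝓝[<] k)
      (𝓝 (Real.Gamma (k - 1) / Real.Gamma (k - 1))) := by
    have hc : ContinuousAt Real.Gamma (k - 1) :=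
      (Real.differentiableAt_Gamma fun m => by
        have : (0 : ℝ) ≤ m := Nat.cast_nonneg m
        linarith).continuousAt
    have h3 : Tendsto (fun lam : ℝ => (k + lam) / 2 - 1) (𝓝[<] k) (𝓝 ((k + k) / 2 - 1)) :=
      (((continuous_const.add continuous_id).div_const 2).sub continuous_const).continuousAt.tendsto
        |>.mono_left nhdsWithin_le_nhds
    rw [show (k + k) / 2 - 1 = k - 1 by ring] at h3
    exact (hc.tendsto.comp h3).div_const _
  rw [div_self hΓ.ne'] at h2
  have h := (tendsto_const_nhds (x := 2 ^ (k - 1) * (√π * Real.Gamma ((k - 1) / 2) / Real.Gamma (k / 2)))).mul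
    (h1.mul h2)
  rw [mul_one, mul_one] at h
  exact h.congr' (e.mono fun lam hlam => hlam.symm)

/-- **THE POLE AT `λ = 2 − k`** (by `W`-symmetry): `(λ − (2 − k)) ∫_G m_k φ_λ dν → 2^{k−1} C_k` as
`λ → (2 − k)⁺`. -/
theorem tendsto_jacobi_nhdsGT {k : ℝ} (hk : 1 < k) :
    Tendsto (fun lam : ℝ => (lam - (2 - k))
        * ∫ g, (1 - ‖orbit g‖ ^ 2) ^ (k / 2) * sph lam g ∂(nu haarCircle))
      (𝓝[>] (2 - k)) (𝓝 (2 ^ (k - 1) * (√π * Real.Gamma ((k - 1) / 2) / Real.Gamma (k / 2)))) := by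
  have h := tendsto_sub_mul_jacobi_nhdsLT hk
  -- substitute `λ ↦ 2 − λ`, which maps `𝓝[>] (2 − k)` onto `𝓝[<] k`
  have hmap : Tendsto (fun lam : ℝ => 2 - lam) (𝓝[>] (2 - k)) (𝓝[<] k) := by
    refine tendsto_nhdsWithin_iff.mpr ⟨?_, eventually_nhdsWithin_of_forall fun lam hlam => ?_⟩
    · have : Tendsto (fun lam : ℝ => 2 - lam) (𝓝 (2 - k)) (𝓝 (2 - (2 - k))) :=
        (continuous_const.sub continuous_id).continuousAt.tendsto
      rw [show (2 : ℝ) - (2 - k) = k by ring] at this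
      exact this.mono_left nhdsWithin_le_nhds
    · have : 2 - k < lam := hlam
      show 2 - lam < k
      linarith
  have h' := h.comp hmap
  refine h'.congr' (eventually_nhdsWithin_of_forall fun lam _ => ?_)
  simp only [Function.comp]
  rw [show k - (2 - lam) = lam - (2 - k) by ring]
  congr 1
  refine integral_congr_ae (Filter.Eventually.of_forall fun g => ?_)
  beta_reduce
  rw [← T5SU11SphericalSymmetry.sph_two_sub lam g]

end measure

end Summit.Ventures.HodgeRepro2.T5SU11CfunPole
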